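import Literature.MathematicalPhysics.QuantumFieldTheory.BalabanImbrieJaffe1984to88.BIJ88RenormTransf311
import Literature.MathematicalPhysics.QuantumFieldTheory.BalabanImbrieJaffe1984to88.BIJ88ComponentResum320

/-!
# `BalabanImbrieJaffe1984to88.BIJ88Eq322Identity` — T. Bałaban, J. Imbrie, A. Jaffe, *Effective action and cluster properties of
the abelian Higgs model*, Commun. Math. Phys. **114** (1988) 257–315 [BalabanImbrieJaffe1988]: **(3.22) PROVED for the model** —
the rewriting (3.14)–(3.21) of the first renormalization transformation (3.11) IS an identity: for CONSTRUCTED term data (small-field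
regions, families `{X_ω}` of connected components, `g₀(X_ω)` of (3.20), `F_{0,loc}(X_σ)` of (3.21)) the (3.22) integrand summed over
all terms equals `F e^{−S} × [ψ-Gaussian]` pointwise, hence every (3.11)-density satisfies (3.22) (file 2 of 2; file 1 =
`BIJ88ComponentResum320`, the regrouping identity)

statement-level skeleton of published theorems with citation tags; proofs where landed; nothing here is a claim about the Yang–Mills mass gap

PDF held: `paper:balaban1988-cmp114-bij-abelian-higgs-effective-action` (journal page = PDF page + 256).  Render read as an
image: PDF p. 12 (journal 268), `HOME/lit-balaban-r16/renders/cmp114/original-p012-x2.png`; pp. 266–269 typed by this seat in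
`BIJ88Sect3Statements`/`BIJ88RenormTransf311` (gens 1–3).

CITATION HEADER (lean-in-tree rule).  Part of the lit-balaban TYPED SKELETON (HOME `run/shared/lean/pub/lit-balaban/`; row
`C2.Eq3.22` (and `C2.Eq3.20`, `C2.Eq3.21`, `C2.Eq3.14`, `C2.Eq3.16`–`C2.Eq3.19`, `C2.Eq3.23` as inputs) of
`HOME/lit-balaban-r18/ROWS-C2.md`; unit `lit-balaban-r18`, gen 6).  WHAT IS REPRODUCED, verbatim, p. 268 [PDF 12]: *"Our density now
takes the following form: ρ₁^L(v, ψ) = Σ_{Λ₀^{(0)}} Σ_{{X_ω}} ∫𝒟u𝒟φ δ(v/Qu)δ_{Ax}(u)ζ_{Λ₀^{(0)c}}χ_{Λ₀^{(0)}} × Π_ω g₀(X_ω) Π_σ F_{0,loc}(X_σ)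
exp[−½⟨Λ₀^{(0)**}f^{(0)}, Λ₀^{(0)**}f^{(0)}⟩ − ½aL⁻²⟨ψ − Q(u)φ, ψ − Q(u)φ⟩ − ½⟨φ, (−Δ_u)φ⟩ − 𝒫_{0,loc}(Λ₀^{(0)}) − ℰ₀ − E^{(0)}],
(3.22)"*, obtained from (3.11) by *"a partition of unity, 1 = Σ_{Λ₀^{(0)}} ζ_{Λ₀^{(0)c}}χ_{Λ₀^{(0)}} (3.14)"*, the expansions (3.16)
(gauge action in `Λ₀^{(0)**}`), (3.17)–(3.18) (observable), the Mayer expansion (3.19), the regrouping into *"connected components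
{X_ω}"* with the activities `g₀(X_ω)` (3.20) and `F_{0,loc}(X_σ)` (3.21), and (3.23) `𝒫_{0,loc}`.

TYPED READING (honest scope).  Gen 3 typed (3.22) as `BIJ88RenormTransf311.Eq322 Qu Qφ a terms T ρ₁` — the (3.11)-type push-forward
identity for the SUMMED integrand of abstract term data `T : ι → Term322` — and proved `eq322_iff_isRT311`: (3.22) ⟺ (3.11) AS SOON AS
the decomposed integrand equals `ρ₀·[ψ-Gaussian]` pointwise (hypothesis `h`).  THIS FILE CONSTRUCTS the term data from the model and
PROVES `h` (`density322_eq`), for: any finite cube type `κ` with a symmetric adjacency `R` and a cube map `cube : T₁ → κ` (the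
r(e₀)-cubes; small-field regions `Λ₀^{(0)}` = `smallRegion cube K₀`, `K₀ ⊆ κ`), any per-cube characteristic values `χ` (the (3.15)
indicators `BIJ88Decomposition314.chi315`, or smooth ones), any observable of the (3.1) product class (`Obs31`: plaquette factors with
their (3.17) splitting, bond factors, site factors — the printed factors are the instance `Obs31.printed`), the action in the form (3.7)
(`action37`; = the model's `rho0` exponent after the rescaling (3.6)–(3.10), `rho0_eq_eval_mul_exp`, via p34's
`BIJ88Sect3Rescaling.actionU1_rescale_eq_BIJ85`).  READING OF RECORD for the memberships of (3.20)–(3.21) (GAPS G-C2-09): every factor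
of `F e^{−S}` has ONE home cube — site terms at the cube of the site, bond factors at the cube of `b₋`, plaquette terms/factors of
`Λ₀^{(0)**}` (all four corner cubes in `K₀`) at a corner cube, plaquette terms/factors NOT in `Λ₀^{(0)**}` at a corner cube OUTSIDE `K₀`
(`homeP`, `homeP_not_mem`) — and *"p ∈ X^{**}"*, *"b ∈ X^{*}"*, *"x ∈ X"* are read "homed in `X`"; the cubes *"covering"* a plaquette
are its home cube; `g₀(X_ω)` carries the constraint that its `S_π`, `S_p` together with `Λ₀^{(0)c} ∩ X_ω` GENERATE `X_ω` (file 1's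
`gfun`).  With these readings (3.22) is an exact identity; without a consistent assignment of the boundary plaquettes it is not
(a plaquette meeting both an `X_ω` and an `X_σ` lies in neither `X_ω^{**}` nor `X_σ^{**}` in the p. 266 sense).  The `δm²` term is
carried with the sign of (3.3)/(3.4) (GAPS G-C2-01).
PROVED (kernel-checked, 0 sorry, no `Prop`-valued definition, standard axioms): `density322_eq`, `eq322_iff`/`eq322_of_isRT311`
((3.22) ⟺ (3.11) for the constructed terms), `rho0_eq_eval_mul_exp`, and the headline `eq322_model`: every `ρ₁^L` with
`IsRT311 Qu Qφ a (rho0 ε e λ δm² E₀ E₁ F) ρ₁^L` satisfies `Eq322 Qu Qφ a terms (term322 …) ρ₁^L` — any block averages; such `ρ₁^L`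
exists for the printed averages with all analytic hypotheses discharged by `BIJ85BlockAveragesTorus.isRT311_printed` (gen 4).
NOT HERE: bounds; the small-field analysis of Sects. 3.2–3.4; the choice of r(e₀)-cubes as actual cubes of side r(e₀) (any partition
`cube` is allowed).
-/

namespace Literature.MathematicalPhysics.QuantumFieldTheory.BalabanImbrieJaffe1984to88.BIJ88Eq322Identity

open Literature.MathematicalPhysics.QuantumFieldTheory.Balaban1983to89
open Literature.Probability.LatticeModels (rcomponents IsRConnected)
open BIJ88Sect3Statements
open BIJ88RenormTransf311 (gaussWeight rho0 IsRT311 Term322 density322 Eq322 eq322_iff_isRT311)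
open BIJ88ComponentResum320
open BIJ85Sect1Model (HiggsField)
open scoped BigOperators
open Complex Finset

noncomputable section

variable {P : Params} {j : ℕ}

/-- kernel (plumbing): decidable equality of bonds through (source, direction). [folklore] -/
private instance instDecEqPBond : DecidableEq (PBond P j) := fun a b =>
  decidable_of_iff (a.src = b.src ∧ a.dir = b.dir)
    ⟨fun h => by cases a; cases b; cases h; congr, fun h => by subst h; exact ⟨rfl, rfl⟩⟩

/-- kernel (plumbing): decidable equality of plaquettes through (source, directions). [folklore] -/
private instance instDecEqPlaq : DecidableEq (Balaban1983to89.Plaq P j) := fun a b =>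
  decidable_of_iff (a.src = b.src ∧ a.μ = b.μ ∧ a.ν = b.ν)
    ⟨fun h => by
      obtain ⟨h1, h2, h3⟩ := h
      cases a; cases b; cases h1; cases h2; cases h3; rfl,
     fun h => by subst h; exact ⟨rfl, rfl, rfl⟩⟩

/-! ## §1 The small-field regions as unions of cubes, and the home cube of a plaquette -/

section Cubes

variable {κ : Type} [DecidableEq κ] (cube : Balaban1983to89.Site P j → κ)

/-- The small-field region `Λ₀^{(0)}` determined by a set `K₀` of r(e₀)-cubes: the sites whose cube lies in `K₀` (p. 267: *"a
decomposition of the lattice into large and small field regions"*, unions of r(e₀)-cubes). [cite: BalabanImbrieJaffe1988, (3.14) p.267] -/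
def smallRegion (K₀ : Finset κ) : Finset (Balaban1983to89.Site P j) := univ.filter fun x => cube x ∈ K₀

/-- Membership in the small-field region. [cite: BalabanImbrieJaffe1988, (3.14) p.267] -/
theorem mem_smallRegion {K₀ : Finset κ} {x : Balaban1983to89.Site P j} : x ∈ smallRegion cube K₀ ↔ cube x ∈ K₀ := by
  simp [smallRegion]

/-- READING OF RECORD for *"r(e₀)-cubes covering … all plaquettes in S_p or S_π"* and for the memberships *"p ∈ X_ω^{**}"*
of (3.20): every plaquette gets ONE home cube — a corner cube OUTSIDE `K₀` if the plaquette is not in `Λ₀^{(0)**}` (so that its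
unexpanded Wilson factor lands in a large-field component `X_ω ⊇` cover of `Λ₀^{(0)c}`), else the cube of its last corner.
[cite: BalabanImbrieJaffe1988, (3.20) p.268] -/
def homeP (K₀ : Finset κ) (p : Balaban1983to89.Plaq P j) : κ :=
  if cube p.src ∉ K₀ then cube p.src
  else if cube (p.src.shift p.μ) ∉ K₀ then cube (p.src.shift p.μ)
  else if cube (p.src.shift p.ν) ∉ K₀ then cube (p.src.shift p.ν)
  else cube ((p.src.shift p.μ).shift p.ν)

/-- `p ∈ Λ₀^{(0)**}` iff all four corner cubes lie in `K₀`. [cite: BalabanImbrieJaffe1988, (3.14) p.267] -/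
theorem mem_starP_smallRegion {K₀ : Finset κ} {p : Balaban1983to89.Plaq P j} :
    p ∈ starP (smallRegion cube K₀) ↔ cube p.src ∈ K₀ ∧ cube (p.src.shift p.μ) ∈ K₀ ∧ cube (p.src.shift p.ν) ∈ K₀ ∧
      cube ((p.src.shift p.μ).shift p.ν) ∈ K₀ := by
  simp [starP, smallRegion]

/-- A plaquette NOT in `Λ₀^{(0)**}` is homed in a cube of the cover of `Λ₀^{(0)c}` (hence inside some `X_ω`: the factor
*"Π_{p∈(π(F)∩X_ω^{**})∖Λ₀^{(0)**}} Re(ieε²)⁻¹(u(p) − 1)"* and the term *"exp[−Σ_{p ∈ X_ω^{…}∖Λ₀^{(0)**}} e₀⁻²(1 − Re u(p))]"* of (3.20)).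
[cite: BalabanImbrieJaffe1988, (3.20) p.268] -/
theorem homeP_not_mem {K₀ : Finset κ} {p : Balaban1983to89.Plaq P j} (hp : p ∉ starP (smallRegion cube K₀)) : homeP cube K₀ p ∉ K₀ := by
  rw [mem_starP_smallRegion] at hp
  unfold homeP
  by_cases h1 : cube p.src ∈ K₀
  · rw [if_neg (not_not.2 h1)]
    by_cases h2 : cube (p.src.shift p.μ) ∈ K₀
    · rw [if_neg (not_not.2 h2)]
      by_cases h3 : cube (p.src.shift p.ν) ∈ K₀
      · rw [if_neg (not_not.2 h3)]
        exact fun h4 => hp ⟨h1, h2, h3, h4⟩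
      · rw [if_pos h3]; exact h3
    · rw [if_pos h2]; exact h2
  · rw [if_pos h1]; exact h1

/-- A plaquette of `Λ₀^{(0)**}` is homed at the cube of its last corner (inside `K₀`). [cite: BalabanImbrieJaffe1988, (3.20) p.268] -/
theorem homeP_of_mem {K₀ : Finset κ} {p : Balaban1983to89.Plaq P j} (hp : p ∈ starP (smallRegion cube K₀)) :
    homeP cube K₀ p = cube ((p.src.shift p.μ).shift p.ν) := by
  rw [mem_starP_smallRegion] at hp
  unfold homeP
  rw [if_neg (not_not.2 hp.1), if_neg (not_not.2 hp.2.1), if_neg (not_not.2 hp.2.2.1)]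

end Cubes

/-! ## §2 The observables of (3.1) as products of factors, and the action in the form (3.7) -/

/-- **The observables of (3.1)** p. 265 [PDF 9]: *"F is a gauge-invariant function, a product of terms like |φ(x)|², φ̄(b₋)u(b)φ(b₊),
Re(ieε²)⁻¹(u(p) − 1)"*; p. 268: *"π(F) is the set of plaquettes having factors Re(ieε²)⁻¹(u(p)−1) in F (with multiplicity).
Denote by β(F), ξ(F) the bond, sites having factors :φ̄(b₋)u(b)φ(b₊):, or :|φ(x)|²: in F"* — as DATA: index types of the three
kinds of factors with their positions and their values as functions of the fields, the plaquette factors together with their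
splitting (3.17) `F_p = F_rel + F_irr` (the printed instance is `Obs31.printed`, with (3.17) = `BIJ88Sect3Statements.eq317`).
[cite: BalabanImbrieJaffe1988, (3.1) p.265] -/
structure Obs31 (P : Params) (j : ℕ) where
  /-- index of the plaquette factors `π(F)` ("with multiplicity") -/
  ιπ : Type
  /-- index of the bond factors `β(F)` -/
  ιβ : Type
  /-- index of the site factors `ξ(F)` -/
  ιξ : Type
  [fπ : Fintype ιπ]
  [dπ : DecidableEq ιπ]
  [fβ : Fintype ιβ]
  [fξ : Fintype ιξ]
  /-- positions -/
  plaq : ιπ → Balaban1983to89.Plaq P j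
  bond : ιβ → PBond P j
  site : ιξ → Balaban1983to89.Site P j
  /-- the plaquette factor and its splitting (3.17) `F_p = F_rel + F_irr` -/
  Fp : ιπ → (PBond P j → ℂ) → ℂ
  Frel : ιπ → (PBond P j → ℂ) → ℂ
  Firr : ιπ → (PBond P j → ℂ) → ℂ
  eq317 : ∀ i u, Fp i u = Frel i u + Firr i u
  /-- the bond factors `:φ̄(b₋)u(b)φ(b₊):` -/
  Wb : ιβ → (PBond P j → ℂ) → HiggsField P j → ℂ
  /-- the site factors `:|φ(x)|²:` -/
  Vx : ιξ → HiggsField P j → ℂ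

attribute [instance] Obs31.fπ Obs31.dπ Obs31.fβ Obs31.fξ

/-- The observable as the product of its factors. [cite: BalabanImbrieJaffe1988, (3.1) p.265] -/
def Obs31.eval (F : Obs31 P j) (u : PBond P j → ℂ) (φ : HiggsField P j) : ℂ :=
  (∏ i, F.Fp i u) * (∏ i, F.Wb i u φ) * ∏ i, F.Vx i φ

/-- The PRINTED factors of (3.1)/(3.17)/(3.18): plaquette factors `Re(ieε²)⁻¹(u(p) − 1) = Re (ie₀)⁻¹ε^{−d/2}(u(p) − 1)` split by
(3.17) into the real parts of r18's `BIJ88Sect3Statements.Frel`/`Firr` (the identity `eq317` is r18's `BIJ88Sect3Statements.eq317`),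
bond factors `:φ̄(b₋)u(b)φ(b₊):` and site factors `:|φ(x)|²:` with their Wick subtractions as DATA (p. 265: the Wick ordering constants
*"will be discussed carefully in a subsequent paper"*). [cite: BalabanImbrieJaffe1988, (3.18) p.268] -/
def Obs31.printed {ιπ ιβ ιξ : Type} [Fintype ιπ] [DecidableEq ιπ] [Fintype ιβ] [Fintype ιξ]
    (plaq : ιπ → Balaban1983to89.Plaq P j) (bond : ιβ → PBond P j) (site : ιξ → Balaban1983to89.Site P j) (ε e₀ : ℝ) (d : ℕ)
    (wβ : ιβ → (PBond P j → ℂ) → ℂ) (wξ : ιξ → ℂ) : Obs31 P j where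
  ιπ := ιπ
  ιβ := ιβ
  ιξ := ιξ
  plaq := plaq
  bond := bond
  site := site
  Fp := fun i u => ((((I * e₀)⁻¹ * ((ε ^ (-(d : ℝ) / 2) : ℝ) : ℂ) * (plaqVar u (plaq i) - 1)).re : ℝ) : ℂ)
  Frel := fun i u => (((BIJ88Sect3Statements.Frel ε e₀ d (fieldStrength e₀ (plaqVar u (plaq i)))).re : ℝ) : ℂ)
  Firr := fun i u =>
    (((BIJ88Sect3Statements.Firr ε e₀ d (plaqVar u (plaq i)) (fieldStrength e₀ (plaqVar u (plaq i)))).re : ℝ) : ℂ)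
  eq317 := fun i u => by
    rw [BIJ88Sect3Statements.eq317 ε e₀ d (plaqVar u (plaq i)) (fieldStrength e₀ (plaqVar u (plaq i))), Complex.add_re]
    push_cast
    rfl
  Wb := fun i u φ => (starRingEnd ℂ) (φ (bond i).src) * u (bond i) * φ (bond i).tgt - wβ i u
  Vx := fun i φ => ((‖φ (site i)‖ ^ 2 : ℝ) : ℂ) - wξ i

/-- The Wilson term `e₀⁻²[1 − Re u(p)]` of the unit-lattice action (3.7). [cite: BalabanImbrieJaffe1988, (3.7) p.266] -/
def wilson (e₀ : ℝ) (u : PBond P j → ℂ) (p : Balaban1983to89.Plaq P j) : ℝ := e₀⁻¹ ^ 2 * (1 - (plaqVar u p).re)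

/-- The site term `P₀(φ(x)) + ½δm²ε²|φ(x)|² + E₁(x)` of (3.7)/(3.20)/(3.23) (p. 268: *"E₁ = Σ_x E₁(x), E₁(x) defined by fixing one
vertex at x for each diagram defining E₁"*). [cite: BalabanImbrieJaffe1988, (3.23) p.269] -/
def siteTerm (P₀ : ℂ → ℝ) (dm2 ε : ℝ) (E₁ : Balaban1983to89.Site P j → ℝ) (φ : HiggsField P j) (x : Balaban1983to89.Site P j) : ℝ :=
  P₀ (φ x) + (1 / 2) * dm2 * ε ^ 2 * ‖φ x‖ ^ 2 + E₁ x

/-- The exponent of **(3.7)** p. 266 [PDF 10]: *"ρ₀(u, φ) = F exp[−Σ_p e₀⁻²[1 − Re u(p)] − ½⟨φ, −Δ_uφ⟩ − Σ_x P₀(φ(x)) − Σ_x ½δm²ε²|φ(x)|²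
− ℰ₀ − E₁]"*, with `⟨φ, −Δ_uφ⟩ = Σ_b |(D_uφ)(b)|²` and `E₁ = Σ_x E₁(x)` distributed over the sites (the model's `rho0` has this
exponent: `rho0_eq_eval_mul_exp`). [cite: BalabanImbrieJaffe1988, (3.7) p.266] -/
def action37 (e₀ : ℝ) (P₀ : ℂ → ℝ) (dm2 ε : ℝ) (E₁ : Balaban1983to89.Site P j → ℝ) (calE₀ : ℝ)
    (u : PBond P j → ℂ) (φ : HiggsField P j) : ℝ :=
  (∑ p, wilson e₀ u p) + (1 / 2) * (∑ b, ‖covD 1 u φ b‖ ^ 2) + (∑ x, siteTerm P₀ dm2 ε E₁ φ x) + calE₀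

/-- The size `|f^{(0)}(p)|` of the field strength `f^{(0)}(p) = (ie₀)⁻¹ log u(p)` ((3.15); real for `|u(p)| = 1`).
[cite: BalabanImbrieJaffe1988, (3.15) p.267] -/
def fS (e₀ : ℝ) (u : PBond P j → ℂ) (p : Balaban1983to89.Plaq P j) : ℝ := ‖fieldStrength e₀ (plaqVar u p)‖

/-- The irrelevant remainder `W₀(p)` of (3.16) at the plaquette `p` (`BIJ88Sect3Statements.W0` of `Re u(p)` and `|f^{(0)}(p)|`).
[cite: BalabanImbrieJaffe1988, (3.16) p.267] -/
def W0p (e₀ : ℝ) (nhalf : ℕ) (u : PBond P j → ℂ) (p : Balaban1983to89.Plaq P j) : ℝ := W0 e₀ nhalf (plaqVar u p).re (fS e₀ u p)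

/-- **(3.16)** at a plaquette: `e₀⁻²[1 − Re u(p)] = ½f^{(0)}(p)² + V₀(p) + W₀(p)` (r18's `BIJ88Sect3Statements.eq316`).
[cite: BalabanImbrieJaffe1988, (3.16) p.267] -/
theorem wilson_eq316 (e₀ : ℝ) (nhalf : ℕ) (u : PBond P j → ℂ) (p : Balaban1983to89.Plaq P j) :
    wilson e₀ u p = (1 / 2) * fS e₀ u p ^ 2 + V0 e₀ nhalf (fS e₀ u p) + W0p e₀ nhalf u p :=
  eq316 e₀ nhalf _ _


/-! ## §3 The expansion data of one small-field region: items, weights, home cubes, cube factors -/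

section Data

variable {κ : Type} [DecidableEq κ] [Fintype κ] (cube : Balaban1983to89.Site P j → κ) (F : Obs31 P j)
variable (e₀ : ℝ) (nhalf : ℕ) (P₀ : ℂ → ℝ) (dm2 ε : ℝ) (E₁ : Balaban1983to89.Site P j → ℝ)

/-- The expandable factors of the small-field region determined by `K₀`: the plaquette factors of `F` in `π(F) ∩ Λ₀^{(0)**}` (left
summand; expanded by (3.17)–(3.18)) and the plaquettes of `Λ₀^{(0)**}` (right summand; Mayer-expanded by (3.19)).
[cite: BalabanImbrieJaffe1988, (3.20) p.268] -/
def items (K₀ : Finset κ) : Finset (F.ιπ ⊕ Balaban1983to89.Plaq P j) :=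
  (univ.filter fun i => F.plaq i ∈ starP (smallRegion cube K₀)).map Function.Embedding.inl ∪
    (starP (smallRegion cube K₀)).map Function.Embedding.inr

/-- The home cube of an expandable factor (that of its plaquette). [cite: BalabanImbrieJaffe1988, (3.20) p.268] -/
def home (K₀ : Finset κ) : F.ιπ ⊕ Balaban1983to89.Plaq P j → κ :=
  Sum.elim (fun i => homeP cube K₀ (F.plaq i)) (homeP cube K₀)

/-- The values of SELECTED factors: `F_irr(p)` for `p ∈ S_π`, `e^{−W₀(p)} − 1` for `p ∈ S_p`. [cite: BalabanImbrieJaffe1988, (3.20) p.268] -/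
def wsel (u : PBond P j → ℂ) : F.ιπ ⊕ Balaban1983to89.Plaq P j → ℂ :=
  Sum.elim (fun i => F.Firr i u) (fun p => ((Real.exp (-W0p e₀ nhalf u p) - 1 : ℝ) : ℂ))

/-- The values of UNSELECTED factors: `F_rel(p)` for `p ∈ S_π^c`, `1` for `p ∉ S_p`. [cite: BalabanImbrieJaffe1988, (3.20) p.268] -/
def wuns (u : PBond P j → ℂ) : F.ιπ ⊕ Balaban1983to89.Plaq P j → ℂ :=
  Sum.elim (fun i => F.Frel i u) (fun _ => 1)

/-- The factors homed at a cube `c` which are NOT expanded — the unsplit plaquette factors of `F` outside `Λ₀^{(0)**}`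
(*"Π_{p∈(π(F)∩X_ω^{**})∖Λ₀^{(0)**}} Re(ieε²)⁻¹(u(p) − 1)"*), the bond and site factors of `F` (*"Π_{b∈β(F)∩X^{*}} :φ̄(b₋)u(b)φ(b₊):
Π_{x∈ξ(F)∩X} :|φ(x)|²:"*, bonds homed at the cube of `b₋`), and *"exp[−Σ_{p∉Λ₀^{(0)**}, home p = c} e₀⁻²(1 − Re u(p)) −
Σ_{x∈c∖Λ₀^{(0)}} (P₀(φ(x)) + ½δm²ε²|φ(x)|² + E₁(x))]"* — the cube-`c` share of (3.20)/(3.21). [cite: BalabanImbrieJaffe1988, (3.20) p.268] -/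
def cubeFactor (K₀ : Finset κ) (u : PBond P j → ℂ) (φ : HiggsField P j) (c : κ) : ℂ :=
  (∏ i ∈ (univ.filter fun i => F.plaq i ∉ starP (smallRegion cube K₀)).filter (fun i => homeP cube K₀ (F.plaq i) = c), F.Fp i u) *
    (∏ i ∈ univ.filter (fun i => cube (F.bond i).src = c), F.Wb i u φ) *
    (∏ i ∈ univ.filter (fun i => cube (F.site i) = c), F.Vx i φ) *
    ((Real.exp (-(∑ p ∈ (univ.filter fun p => p ∉ starP (smallRegion cube K₀)).filter (fun p => homeP cube K₀ p = c),
        wilson e₀ u p) -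
        ∑ x ∈ (univ.filter fun x => cube x ∉ K₀).filter (fun x => cube x = c), siteTerm P₀ dm2 ε E₁ φ x) : ℝ) : ℂ)

variable {cube F e₀ nhalf P₀ dm2 ε E₁}

omit [Fintype κ] in
/-- **(3.18)–(3.19) read backwards**: the fully expanded product over the expandable factors is `Π_{π(F)∩Λ₀^{(0)**}} F_p(u) ·
exp[−Σ_{Λ₀^{(0)**}} W₀(p)]` (`F_irr + F_rel = F_p` by (3.17), `(e^{−W₀} − 1) + 1 = e^{−W₀}`; the expansions themselves are r18's
`BIJ88Sect3Expansion.eq318` and `BIJ88Sect3Statements.mayer_319`). [cite: BalabanImbrieJaffe1988, (3.19) p.268] -/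
theorem prod_items (K₀ : Finset κ) (u : PBond P j → ℂ) :
    ∏ e ∈ items cube F K₀, (wsel F e₀ nhalf u e + wuns F u e) =
      (∏ i ∈ univ.filter (fun i => F.plaq i ∈ starP (smallRegion cube K₀)), F.Fp i u) *
        ((Real.exp (-∑ p ∈ starP (smallRegion cube K₀), W0p e₀ nhalf u p) : ℝ) : ℂ) := by
  have hdj : Disjoint ((univ.filter fun i => F.plaq i ∈ starP (smallRegion cube K₀)).map Function.Embedding.inl)
      ((starP (smallRegion cube K₀)).map (Function.Embedding.inr : Balaban1983to89.Plaq P j ↪ F.ιπ ⊕ _)) := by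
    rw [Finset.disjoint_left]
    intro e h1 h2
    obtain ⟨i, -, rfl⟩ := mem_map.1 h1
    obtain ⟨p, -, hp⟩ := mem_map.1 h2
    exact Sum.inr_ne_inl hp
  rw [items, prod_union hdj, prod_map, prod_map]
  congr 1
  · refine prod_congr rfl fun i _ => ?_
    simp only [wsel, wuns, Function.Embedding.inl_apply, Sum.elim_inl]
    rw [F.eq317, add_comm]
  · rw [← sum_neg_distrib, Real.exp_sum, Complex.ofReal_prod]
    refine prod_congr rfl fun p _ => ?_
    simp only [wsel, wuns, Function.Embedding.inr_apply, Sum.elim_inr]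
    push_cast
    ring

/-- The cube factors multiply, over all cubes, to the unexpanded factors of `F` times the exponential of the action terms outside
the small-field region (every factor has exactly one home cube). [cite: BalabanImbrieJaffe1988, (3.20) p.268] -/
theorem prod_cubeFactor (K₀ : Finset κ) (u : PBond P j → ℂ) (φ : HiggsField P j) :
    ∏ c, cubeFactor cube F e₀ P₀ dm2 ε E₁ K₀ u φ c =
      (∏ i ∈ univ.filter (fun i => F.plaq i ∉ starP (smallRegion cube K₀)), F.Fp i u) * (∏ i, F.Wb i u φ) * (∏ i, F.Vx i φ) *
        ((Real.exp (-(∑ p ∈ univ.filter (fun p => p ∉ starP (smallRegion cube K₀)), wilson e₀ u p) -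
            ∑ x ∈ univ.filter (fun x => cube x ∉ K₀), siteTerm P₀ dm2 ε E₁ φ x) : ℝ) : ℂ) := by
  simp only [cubeFactor, prod_mul_distrib]
  congr 1
  · congr 1
    · congr 1
      · exact prod_fiberwise_of_maps_to (fun _ _ => mem_univ _) _
      · exact prod_fiberwise_of_maps_to (fun _ _ => mem_univ _) _
    · exact prod_fiberwise_of_maps_to (fun _ _ => mem_univ _) _
  · rw [← Complex.ofReal_prod, ← Real.exp_sum]
    congr 2
    rw [sum_sub_distrib, sum_neg_distrib, sum_fiberwise_of_maps_to (fun _ _ => mem_univ _),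
      sum_fiberwise_of_maps_to (fun _ _ => mem_univ _)]

end Data


/-! ## §4 The exponent bookkeeping (3.16)/(3.23) and the pointwise identity for one small-field region -/

section Core

variable {κ : Type} [DecidableEq κ] [Fintype κ] {cube : Balaban1983to89.Site P j → κ} {F : Obs31 P j}
variable {e₀ : ℝ} {nhalf : ℕ} {P₀ : ℂ → ℝ} {dm2 ε : ℝ} {E₁ : Balaban1983to89.Site P j → ℝ}

omit [Fintype κ] in
/-- **The exponent bookkeeping**: the exponent of (3.22) (`−½⟨Λ₀**f, Λ₀**f⟩ − ½⟨φ, −Δ_uφ⟩ − 𝒫_{0,loc}(Λ₀) − ℰ₀`, with (3.23)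
`𝒫_{0,loc}` = r18's `BIJ88Sect3Statements.P0loc`), plus the Mayer exponent `−Σ_{Λ₀**} W₀` of (3.19), plus the exponents moved
into the `g₀(X_ω)` of (3.20) (Wilson terms outside `Λ₀**`, site terms outside `Λ₀`), IS minus the action (3.7) — by (3.16) on
`Λ₀^{(0)**}`. [cite: BalabanImbrieJaffe1988, (3.23) p.269] -/
theorem exponent_identity (cube : Balaban1983to89.Site P j → κ) (e₀ : ℝ) (nhalf : ℕ) (P₀ : ℂ → ℝ) (dm2 ε : ℝ)
    (E₁ : Balaban1983to89.Site P j → ℝ) (calE₀ : ℝ) (K₀ : Finset κ) (u : PBond P j → ℂ) (φ : HiggsField P j) :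
    (-(1 / 2) * (∑ p ∈ starP (smallRegion cube K₀), fS e₀ u p ^ 2) - (1 / 2) * (∑ b, ‖covD 1 u φ b‖ ^ 2)
        - P0loc P₀ dm2 ε E₁ (fun p => V0 e₀ nhalf (fS e₀ u p)) φ (smallRegion cube K₀) - calE₀)
      + (-∑ p ∈ starP (smallRegion cube K₀), W0p e₀ nhalf u p)
      + (-(∑ p ∈ univ.filter (fun p => p ∉ starP (smallRegion cube K₀)), wilson e₀ u p)
          - ∑ x ∈ univ.filter (fun x => cube x ∉ K₀), siteTerm P₀ dm2 ε E₁ φ x) =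
      -action37 e₀ P₀ dm2 ε E₁ calE₀ u φ := by
  have hP : ∑ p, wilson e₀ u p = (∑ p ∈ starP (smallRegion cube K₀), wilson e₀ u p) +
      ∑ p ∈ univ.filter (fun p => p ∉ starP (smallRegion cube K₀)), wilson e₀ u p := by
    rw [← sum_filter_add_sum_filter_not univ (fun p => p ∈ starP (smallRegion cube K₀))]
    congr 1
    refine sum_congr ?_ fun _ _ => rfl
    ext p; simp
  have hX : ∑ x, siteTerm P₀ dm2 ε E₁ φ x =
      (∑ x ∈ smallRegion cube K₀, siteTerm P₀ dm2 ε E₁ φ x) + ∑ x ∈ univ.filter (fun x => cube x ∉ K₀), siteTerm P₀ dm2 ε E₁ φ x := by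
    rw [← sum_filter_add_sum_filter_not univ (fun x => cube x ∈ K₀)]
    rfl
  have h316 : ∑ p ∈ starP (smallRegion cube K₀), wilson e₀ u p =
      ∑ p ∈ starP (smallRegion cube K₀), ((1 / 2) * fS e₀ u p ^ 2 + V0 e₀ nhalf (fS e₀ u p) + W0p e₀ nhalf u p) :=
    sum_congr rfl fun p _ => wilson_eq316 e₀ nhalf u p
  rw [action37, hP, hX, h316, P0loc]
  simp only [siteTerm, sum_add_distrib, ← Finset.mul_sum]
  ring

/-- The pointwise identity for ONE small-field region, before regrouping: exponential of (3.22) × (fully expanded product) × (all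
cube factors) = `F · e^{−S}` with `S` the action (3.7). [cite: BalabanImbrieJaffe1988, (3.22) p.268] -/
theorem core_identity (calE₀ : ℝ) (K₀ : Finset κ) (u : PBond P j → ℂ) (φ : HiggsField P j) :
    ((Real.exp (-(1 / 2) * (∑ p ∈ starP (smallRegion cube K₀), fS e₀ u p ^ 2) - (1 / 2) * (∑ b, ‖covD 1 u φ b‖ ^ 2)
        - P0loc P₀ dm2 ε E₁ (fun p => V0 e₀ nhalf (fS e₀ u p)) φ (smallRegion cube K₀) - calE₀) : ℝ) : ℂ) *
      ((∏ e ∈ items cube F K₀, (wsel F e₀ nhalf u e + wuns F u e)) * ∏ c, cubeFactor cube F e₀ P₀ dm2 ε E₁ K₀ u φ c) =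
      F.eval u φ * ((Real.exp (-action37 e₀ P₀ dm2 ε E₁ calE₀ u φ) : ℝ) : ℂ) := by
  rw [prod_items, prod_cubeFactor, Obs31.eval,
    ← prod_filter_mul_prod_filter_not univ (fun i => F.plaq i ∈ starP (smallRegion cube K₀)) (fun i => F.Fp i u),
    ← exponent_identity cube e₀ nhalf P₀ dm2 ε E₁ calE₀ K₀ u φ, Real.exp_add, Real.exp_add]
  push_cast
  ring

/-- **The regrouping (3.20)–(3.22) for the model's data** (file 1's `resum320_components` + `sum_wt_mul_eq`): the sum over the
families `{X_ω}` of connected components covering `Λ₀^{(0)c}` of `Π_ω g₀(X_ω) · Π_σ F_{0,loc}(X_σ)` equals (fully expanded product) ×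
(all cube factors). [cite: BalabanImbrieJaffe1988, (3.22) p.268] -/
theorem gas_sum_eq {R : κ → κ → Prop} [DecidableRel R] (hR : ∀ x y, R x y → R y x) (K₀ : Finset κ) (u : PBond P j → ℂ)
    (φ : HiggsField P j) :
    ∑ 𝒢 ∈ (gases R).filter (fun 𝒢 => K₀ᶜ ⊆ 𝒢.biUnion id),
        (∏ X ∈ 𝒢, gfun (items cube F K₀) (home cube F K₀) (wsel F e₀ nhalf u) (wuns F u) K₀ᶜ
            (cubeFactor cube F e₀ P₀ dm2 ε E₁ K₀ u φ) X) *
          ∏ Y ∈ rcomponents R (𝒢.biUnion id)ᶜ, ∏ c ∈ Y,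
            (cubeFactor cube F e₀ P₀ dm2 ε E₁ K₀ u φ c *
              ∏ e ∈ (items cube F K₀).filter (fun e => home cube F K₀ e = c), wuns F u e) =
      (∏ e ∈ items cube F K₀, (wsel F e₀ nhalf u e + wuns F u e)) * ∏ c, cubeFactor cube F e₀ P₀ dm2 ε E₁ K₀ u φ c := by
  rw [← resum320_components hR, sum_wt_mul_eq]

end Core


/-! ## §5 The terms of (3.22) for the model and the pointwise identity `density322 = ρ₀ · [ψ-Gaussian]` -/

section Terms

variable {κ : Type} [DecidableEq κ] [Fintype κ] (R : κ → κ → Prop) [DecidableRel R]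
variable (cube : Balaban1983to89.Site P j → κ) (F : Obs31 P j)
variable (e₀ : ℝ) (nhalf : ℕ) (P₀ : ℂ → ℝ) (dm2 ε : ℝ) (E₁ : Balaban1983to89.Site P j → ℝ)
variable (χ : κ → (PBond P j → ℂ) → HiggsField P j → (Balaban1983to89.Site P (j + 1) → ℂ) → ℝ) (calE₀ : ℝ)

/-- The index set of the double sum *"Σ_{Λ₀^{(0)}} Σ_{{X_ω}}"* of (3.22): small-field cube sets `K₀` and families `{X_ω}` of pairwise
non-touching `R`-connected cube sets whose union contains the cover `K₀ᶜ` of `Λ₀^{(0)c}` (file 1's `gases`). [cite: BalabanImbrieJaffe1988, (3.22) p.268] -/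
def terms : Finset (Σ _ : Finset κ, Finset (Finset κ)) :=
  (univ : Finset κ).powerset.sigma fun K₀ => (gases R).filter fun 𝒢 => K₀ᶜ ⊆ 𝒢.biUnion id

/-- **The CONSTRUCTED data of one term of (3.22)** (r18's `BIJ88RenormTransf311.Term322`): `Λ₀ = Λ₀(K₀)`; `Ω = {X_ω} = 𝒢`; the observable
components `{X_σ}` = the `R`-components of `(⋃𝒢)ᶜ`; `ζ_{Λ₀^c}χ_{Λ₀}` = r18's `BIJ88Decomposition314.zeta`/`chi` of the per-cube
characteristic values `χ`; `g₀(X_ω)` = file 1's `gfun` (**(3.20) with the generating constraint**, reading note GAPS G-C2-09) of the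
expansion data `items`/`home`/`wsel`/`wuns` and the cube factors `cubeFactor`; `F_{0,loc}(X_σ)` = the product over the cubes of `X_σ`
of the cube factors and the unselected `F_rel` homed there (**(3.21)**); `𝒫_{0,loc}(Λ₀)` = r18's `P0loc` with `V₀(p) = V₀(|f(p)|)`; `ℰ₀`.
[cite: BalabanImbrieJaffe1988, (3.22) p.268] -/
def term322 (t : Σ _ : Finset κ, Finset (Finset κ)) : Term322 P j where
  Λ₀ := smallRegion cube t.1
  Ω := ↥t.2
  Obs := ↥(rcomponents R (t.2.biUnion id)ᶜ)
  zetaChi := fun u φ ψ =>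
    BIJ88Decomposition314.zeta (fun q => χ q u φ ψ) (univ \ t.1) * BIJ88Decomposition314.chi (fun q => χ q u φ ψ) t.1
  g0 := fun X u φ => gfun (items cube F t.1) (home cube F t.1) (wsel F e₀ nhalf u) (wuns F u) t.1ᶜ
    (cubeFactor cube F e₀ P₀ dm2 ε E₁ t.1 u φ) X.1
  F0loc := fun Y u φ => ∏ c ∈ Y.1, (cubeFactor cube F e₀ P₀ dm2 ε E₁ t.1 u φ c *
    ∏ e ∈ (items cube F t.1).filter (fun e => home cube F t.1 e = c), wuns F u e)
  e₀ := e₀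
  P0loc := fun u φ => P0loc P₀ dm2 ε E₁ (fun p => V0 e₀ nhalf (fS e₀ u p)) φ (smallRegion cube t.1)
  calE0 := calE₀

variable {R cube F e₀ nhalf P₀ dm2 ε E₁ χ calE₀}

omit [DecidableRel R] in
/-- Unfolding the bracket of (3.22) for the constructed term. [cite: BalabanImbrieJaffe1988, (3.22) p.268] -/
theorem integrand_term322 (t : Σ _ : Finset κ, Finset (Finset κ)) (a : ℝ)
    (Qφ : GaugeField P j U1 → HiggsField P j → (Balaban1983to89.Site P (j + 1) → ℂ))
    (U : GaugeField P j U1) (φ : HiggsField P j) (ψ : Balaban1983to89.Site P (j + 1) → ℂ) :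
    (term322 R cube F e₀ nhalf P₀ dm2 ε E₁ χ calE₀ t).integrand a Qφ U φ ψ =
      ((BIJ88Decomposition314.zeta (fun q => χ q (cfg U) φ ψ) (univ \ t.1) *
          BIJ88Decomposition314.chi (fun q => χ q (cfg U) φ ψ) t.1 : ℝ) : ℂ) *
        (((∏ X ∈ t.2, gfun (items cube F t.1) (home cube F t.1) (wsel F e₀ nhalf (cfg U)) (wuns F (cfg U)) t.1ᶜ
              (cubeFactor cube F e₀ P₀ dm2 ε E₁ t.1 (cfg U) φ) X) *
            ∏ Y ∈ rcomponents R (t.2.biUnion id)ᶜ, ∏ c ∈ Y, (cubeFactor cube F e₀ P₀ dm2 ε E₁ t.1 (cfg U) φ c *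
              ∏ e ∈ (items cube F t.1).filter (fun e => home cube F t.1 e = c), wuns F (cfg U) e)) *
          (((Real.exp (-(1 / 2) * (∑ p ∈ starP (smallRegion cube t.1), fS e₀ (cfg U) p ^ 2)
              - (1 / 2) * (∑ b, ‖covD 1 (cfg U) φ b‖ ^ 2)
              - P0loc P₀ dm2 ε E₁ (fun p => V0 e₀ nhalf (fS e₀ (cfg U) p)) φ (smallRegion cube t.1) - calE₀) : ℝ) : ℂ) *
            (gaussWeight a (Qφ U φ) ψ : ℂ))) := by
  unfold Term322.integrand term322
  simp only
  rw [Finset.prod_coe_sort t.2 (fun X => gfun (items cube F t.1) (home cube F t.1) (wsel F e₀ nhalf (cfg U)) (wuns F (cfg U)) t.1ᶜ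
      (cubeFactor cube F e₀ P₀ dm2 ε E₁ t.1 (cfg U) φ) X),
    Finset.prod_coe_sort (rcomponents R (t.2.biUnion id)ᶜ) (fun Y => ∏ c ∈ Y,
      (cubeFactor cube F e₀ P₀ dm2 ε E₁ t.1 (cfg U) φ c *
        ∏ e ∈ (items cube F t.1).filter (fun e => home cube F t.1 e = c), wuns F (cfg U) e))]
  simp only [fS]
  ring

/-- **THE POINTWISE IDENTITY BEHIND (3.22)**: for every configuration `(u, φ, ψ)`, the (3.22) integrand summed over the constructed
terms — `Σ_{Λ₀} Σ_{{X_ω}} ζ_{Λ₀^c}χ_{Λ₀} Π_ω g₀(X_ω) Π_σ F_{0,loc}(X_σ) exp[−½⟨Λ₀**f,Λ₀**f⟩ − ½aL⁻²⟨ψ−Q(u)φ,ψ−Q(u)φ⟩ − ½⟨φ,−Δ_uφ⟩ −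
𝒫_{0,loc}(Λ₀) − ℰ₀ − E^{(0)}]` — EQUALS `F(u,φ)·e^{−S(u,φ)}·[ψ-Gaussian]`, the integrand of (3.11): by (3.14) (`insert314`), (3.16)
(`exponent_identity`), (3.17)–(3.19) (`prod_items`), and the regrouping (`gas_sum_eq`). Every symmetric adjacency `R`, every cube
assignment, every family `χ` of cube characteristic values, every (3.1)-type observable. [cite: BalabanImbrieJaffe1988, (3.22) p.268] -/
theorem density322_eq (hR : ∀ x y, R x y → R y x) (a : ℝ)
    (Qφ : GaugeField P j U1 → HiggsField P j → (Balaban1983to89.Site P (j + 1) → ℂ))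
    (U : GaugeField P j U1) (φ : HiggsField P j) (ψ : Balaban1983to89.Site P (j + 1) → ℂ) :
    density322 (terms R) (term322 R cube F e₀ nhalf P₀ dm2 ε E₁ χ calE₀) a Qφ U φ ψ =
      F.eval (cfg U) φ * ((Real.exp (-action37 e₀ P₀ dm2 ε E₁ calE₀ (cfg U) φ) : ℝ) : ℂ) * (gaussWeight a (Qφ U φ) ψ : ℂ) := by
  rw [density322, terms, sum_sigma]
  have hK : ∀ K₀ : Finset κ,
      ∑ 𝒢 ∈ (gases R).filter (fun 𝒢 => K₀ᶜ ⊆ 𝒢.biUnion id),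
          (term322 R cube F e₀ nhalf P₀ dm2 ε E₁ χ calE₀ ⟨K₀, 𝒢⟩).integrand a Qφ U φ ψ =
        ((BIJ88Decomposition314.zeta (fun q => χ q (cfg U) φ ψ) (univ \ K₀) *
            BIJ88Decomposition314.chi (fun q => χ q (cfg U) φ ψ) K₀ : ℝ) : ℂ) *
          (F.eval (cfg U) φ * ((Real.exp (-action37 e₀ P₀ dm2 ε E₁ calE₀ (cfg U) φ) : ℝ) : ℂ) *
            (gaussWeight a (Qφ U φ) ψ : ℂ)) := by
    intro K₀
    simp_rw [integrand_term322]
    rw [← mul_sum, ← sum_mul, gas_sum_eq hR, ← core_identity calE₀ K₀ (cfg U) φ]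
    ring
  simp_rw [hK]
  exact BIJ88RenormTransf311.insert314 univ (fun q => χ q (cfg U) φ ψ) _

/-- **(3.22) for every (3.11)-density of `F e^{−S}`**: the hypothesis `h` of r18's `BIJ88RenormTransf311.eq322_iff_isRT311` discharged.
[cite: BalabanImbrieJaffe1988, (3.22) p.268] -/
theorem eq322_of_isRT311 (hR : ∀ x y, R x y → R y x) {Qu : GaugeField P j U1 → GaugeField P (j + 1) U1}
    {Qφ : GaugeField P j U1 → HiggsField P j → (Balaban1983to89.Site P (j + 1) → ℂ)} {a : ℝ}
    {ρ₁ : GaugeField P (j + 1) U1 → (Balaban1983to89.Site P (j + 1) → ℂ) → ℂ}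
    (h311 : IsRT311 Qu Qφ a (fun U φ => F.eval (cfg U) φ * ((Real.exp (-action37 e₀ P₀ dm2 ε E₁ calE₀ (cfg U) φ) : ℝ) : ℂ)) ρ₁) :
    Eq322 Qu Qφ a (terms R) (term322 R cube F e₀ nhalf P₀ dm2 ε E₁ χ calE₀) ρ₁ :=
  (eq322_iff_isRT311 (fun U φ ψ => density322_eq hR a Qφ U φ ψ) ρ₁).2 h311

/-- **(3.22) ⟺ (3.11)** for the constructed terms (any block averages `Qu`, `Q(u)φ`, any `a`). [cite: BalabanImbrieJaffe1988, (3.22) p.268] -/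
theorem eq322_iff (hR : ∀ x y, R x y → R y x) {Qu : GaugeField P j U1 → GaugeField P (j + 1) U1}
    {Qφ : GaugeField P j U1 → HiggsField P j → (Balaban1983to89.Site P (j + 1) → ℂ)} {a : ℝ}
    (ρ₁ : GaugeField P (j + 1) U1 → (Balaban1983to89.Site P (j + 1) → ℂ) → ℂ) :
    Eq322 Qu Qφ a (terms R) (term322 R cube F e₀ nhalf P₀ dm2 ε E₁ χ calE₀) ρ₁ ↔
      IsRT311 Qu Qφ a (fun U φ => F.eval (cfg U) φ * ((Real.exp (-action37 e₀ P₀ dm2 ε E₁ calE₀ (cfg U) φ) : ℝ) : ℂ)) ρ₁ :=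
  eq322_iff_isRT311 (fun U φ ψ => density322_eq hR a Qφ U φ ψ) ρ₁

end Terms


/-! ## §6 The model's density `rho0` of (3.7)/(3.11) IS of the form (3.7) used above: (3.22) for the printed model -/

section Rho0

/-- p. 266: *"Each factor φ in F acquires a factor ε^{−(d−2)/2}, but we use the same notation"* — the observable with its scalar
arguments rescaled. [cite: BalabanImbrieJaffe1988, (3.7) p.266] -/
def Obs31.rescale (F : Obs31 P j) (s : ℝ) : Obs31 P j :=
  { F with Wb := fun i u φ => F.Wb i u (s • φ), Vx := fun i φ => F.Vx i (s • φ) }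

/-- unfolding. [cite: BalabanImbrieJaffe1988, (3.7) p.266] -/
theorem Obs31.eval_rescale (F : Obs31 P j) (s : ℝ) (u : PBond P j → ℂ) (φ : HiggsField P j) :
    (F.rescale s).eval u φ = F.eval u (s • φ) := rfl

/-- `P₀` = **(3.8)** at `k = 0`: `λ₀|φ|⁴ − ¼ε²|φ|² + (1/64λ)ε^d`, `λ₀ = ε^{4−d}λ` ((3.9); `BIJ88Sect4Statements.Pk`).
[cite: BalabanImbrieJaffe1988, (3.8) p.266] -/
def P0eps (ε lam : ℝ) (d : ℕ) : ℂ → ℝ := BIJ88Sect4Statements.Pk (BIJ85Sect1Model.lamEps lam ε d) ε lam d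

/-- The rescaled action in C1's unit-lattice form (p34's `BIJ88Sect3Rescaling.action_rescale_eq_BIJ85`: charge `e(ε)`, coupling
`λ(ε)`, mass term `(1+2δm²)ε²`, constant `E + E₁ + |T₁|ε^d/(64λ)`) IS `action37` with `P₀` = (3.8), the `δm²`-term carried with the
sign of (3.3)/(3.4) (`−δm²`; the `+` printed in (3.7)/(3.23) is GAPS G-C2-01), and any distribution `E₁(x)` of `E₁` over the sites
(dictionary `BIJ88Sect3ModelBridge.plaqVar_coe`/`covD_one_coe`). [cite: BalabanImbrieJaffe1988, (3.7) p.266] -/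
theorem action_BIJ85_eq_action37 {ε : ℝ} (e lam dm2 E E₁ : ℝ) {E₁x : Balaban1983to89.Site P j → ℝ} (hE₁ : ∑ x, E₁x x = E₁)
    (u : BIJ85Sect1Model.U1Field P j) (φ : HiggsField P j) :
    BIJ85Sect1Model.action (BIJ85Sect1Model.eEps e ε P.d) (BIJ85Sect1Model.lamEps lam ε P.d) ((1 + 2 * dm2) * ε ^ 2)
        (E + E₁ + Fintype.card (Balaban1983to89.Site P j) * ε ^ P.d / (64 * lam)) u φ =
      action37 (BIJ85Sect1Model.eEps e ε P.d) (P0eps ε lam P.d) (-dm2) ε E₁x E (fun b => (u b : ℂ)) φ := by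
  have hsite : ∀ x, siteTerm (P0eps ε lam P.d) (-dm2) ε E₁x φ x =
      BIJ85Sect1Model.selfInt (BIJ85Sect1Model.lamEps lam ε P.d) ((1 + 2 * dm2) * ε ^ 2) (φ x) + ε ^ P.d / (64 * lam) + E₁x x := by
    intro x
    simp only [siteTerm, P0eps, BIJ88Sect4Statements.Pk, BIJ85Sect1Model.selfInt]
    ring
  simp only [action37, BIJ85Sect1Model.action, wilson, BIJ88Sect3ModelBridge.plaqVar_coe, BIJ88Sect3ModelBridge.covD_one_coe,
    hsite, sum_add_distrib, sum_const, card_univ, nsmul_eq_mul, hE₁]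
  ring

/-- **The model's `rho0` is of the form (3.7) used here**: `rho0 ε e λ δm² E₀ E₁ F = F_{rescaled} · exp(−action37 …)` with
`e₀ = e(ε)`, `P₀` = (3.8), `ℰ₀` = (3.10) `calE0`, `E₁ = Σ_x E₁(x)`. [cite: BalabanImbrieJaffe1988, (3.7) p.266] -/
theorem rho0_eq_eval_mul_exp {ε : ℝ} (hε : 0 < ε) (e lam dm2 E₀ E₁ : ℝ) {E₁x : Balaban1983to89.Site P j → ℝ}
    (hE₁ : ∑ x, E₁x x = E₁) (F : Obs31 P j) (U : GaugeField P j U1) (φ : HiggsField P j) :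
    rho0 ε e lam dm2 E₀ E₁ (fun U φ => F.eval (cfg U) φ) U φ =
      (F.rescale (BIJ88Sect3Rescaling.phiScale ε P.d)).eval (cfg U) φ *
        ((Real.exp (-action37 (BIJ85Sect1Model.eEps e ε P.d) (P0eps ε lam P.d) (-dm2) ε E₁x
          (calE0 E₀ P.d (Fintype.card (Balaban1983to89.Site P j)) ε) (cfg U) φ) : ℝ) : ℂ) := by
  rw [rho0, BIJ88Sect3Rescaling.actionU1_rescale_eq_BIJ85 hε, action_BIJ85_eq_action37 e lam dm2 _ E₁ hE₁,
    BIJ88Sect3Rescaling.coe_fieldEquiv_symm, Obs31.eval_rescale, mul_comm]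

variable {κ : Type} [DecidableEq κ] [Fintype κ] {R : κ → κ → Prop} [DecidableRel R]

/-- **(3.22) FOR THE PRINTED MODEL**: every `ρ₁^L` satisfying (3.11) for the model's density `rho0 ε e λ δm² E₀ E₁ F` (`F` a
(3.1)-type product observable read on `U(1)` configurations; such `ρ₁^L` EXISTS with every analytic hypothesis discharged for the
printed block averages by r18's `BIJ85BlockAveragesTorus.isRT311_printed`, given measurability, gauge invariance and polynomial
bounds of `F`) satisfies **(3.22)** `Eq322` with the CONSTRUCTED terms: small-field regions = unions of cubes, `{X_ω}` = families
of pairwise non-touching connected cube sets covering `Λ₀^{(0)c}`, `g₀` = (3.20) with the generating constraint, `F_{0,loc}` = (3.21)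
over the components of the rest, `e₀ = e(ε)`, `P₀` = (3.8), `ℰ₀` = (3.10) — for every symmetric cube adjacency `R`, cube map, cube
characteristic values `χ` (e.g. r18's `BIJ88Decomposition314.chi315` of (3.15)), `n̄`, and distribution `E₁(x)` of `E₁`.
[cite: BalabanImbrieJaffe1988, (3.22) p.268] -/
theorem eq322_model (hR : ∀ x y, R x y → R y x) (cube : Balaban1983to89.Site P j → κ) (F : Obs31 P j) (nhalf : ℕ)
    (χ : κ → (PBond P j → ℂ) → HiggsField P j → (Balaban1983to89.Site P (j + 1) → ℂ) → ℝ)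
    {ε : ℝ} (hε : 0 < ε) (e lam dm2 E₀ E₁ : ℝ) {E₁x : Balaban1983to89.Site P j → ℝ} (hE₁ : ∑ x, E₁x x = E₁)
    {Qu : GaugeField P j U1 → GaugeField P (j + 1) U1}
    {Qφ : GaugeField P j U1 → HiggsField P j → (Balaban1983to89.Site P (j + 1) → ℂ)} {a : ℝ}
    {ρ₁ : GaugeField P (j + 1) U1 → (Balaban1983to89.Site P (j + 1) → ℂ) → ℂ}
    (h311 : IsRT311 Qu Qφ a (rho0 ε e lam dm2 E₀ E₁ (fun U φ => F.eval (cfg U) φ)) ρ₁) :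
    Eq322 Qu Qφ a (terms R)
      (term322 R cube (F.rescale (BIJ88Sect3Rescaling.phiScale ε P.d)) (BIJ85Sect1Model.eEps e ε P.d) nhalf (P0eps ε lam P.d)
        (-dm2) ε E₁x χ (calE0 E₀ P.d (Fintype.card (Balaban1983to89.Site P j)) ε)) ρ₁ := by
  refine eq322_of_isRT311 hR ?_
  have hρ : (fun U φ => (F.rescale (BIJ88Sect3Rescaling.phiScale ε P.d)).eval (cfg U) φ *
      ((Real.exp (-action37 (BIJ85Sect1Model.eEps e ε P.d) (P0eps ε lam P.d) (-dm2) ε E₁x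
        (calE0 E₀ P.d (Fintype.card (Balaban1983to89.Site P j)) ε) (cfg U) φ) : ℝ) : ℂ)) =
      rho0 ε e lam dm2 E₀ E₁ (fun U φ => F.eval (cfg U) φ) := by
    funext U φ
    exact (rho0_eq_eval_mul_exp hε e lam dm2 E₀ E₁ hE₁ F U φ).symm
  rw [hρ]
  exact h311

end Rho0

end

end Literature.MathematicalPhysics.QuantumFieldTheory.BalabanImbrieJaffe1984to88.BIJ88Eq322Identity
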